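import Summits.HodgeConjecture.CorCM.GaloisCyclicSemidirectTwoPowerTwoSheet
import Summits.HodgeConjecture.CorCM.CyclotomicTwoPowerPNormObstruction
import Summits.HodgeConjecture.CorCM.GaloisDicyclicNondegenerate
import HarnessLib

/-!
# Galois CM fields with group `C_p ⋊ C_{2^{a+2}}`, `v₂(p − 1) = a + 1`: every primitive CM type is nondegenerate —
# the Hodge conjecture for all powers of their simple CM abelian `2^{a+1}p`-folds

COR-CM (cell `pub-hodgecm2`), binder seat b04 (gen 25), count-neutral claim CYCLIC-SEMIDIRECT-TWO-POWER, parts II + IV (the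
theorem on CM fields and the unconditional capstone; part I `CorCM/GaloisCyclicSemidirectTwoPowerTwoSheet` is the
group-theoretic core, part III `CorCM/CyclotomicTwoPowerP{Integers,NormDescent,NormObstruction}` the arithmetic).  KERNEL
ONLY: theorems; no definition, no named fact, no `sorry`.  `HC_CM` is neither used nor claimed: this is the Hodge conjecture
for a NAMED CLASS of CM abelian varieties, proved outright.

SETTING.  `K` a Galois CM field with `Gal(K/ℚ) ≅ C_p ⋊ C_{2^{a+2}} = ⟨u, y | u^p = y^{2^{a+2}} = 1, y u y⁻¹ = u⁻¹⟩`
(Mathlib model `Multiplicative (ZMod p) ⋊[φ] Multiplicative (ZMod (2^(a+2)))`, `φ(1)` = inversion), `p` an odd prime;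
`[K:ℚ] = 2^{a+2} p`; complex conjugation is the UNIQUE involution `y^{2^{a+1}}`.  These are the metacyclic groups of gen 20's
list (iii) «unique involution, cyclic Sylow `2`-subgroup acting on `C_p` through inversion»: `a = 0` is the dicyclic group
`Dic_p` (GOOD for every `p`, gen 20), `a = 1` is `C_p ⋊ C₈` (GOOD for `p ≡ 5 (mod 8)`, claim CYCLIC-SEMIDIRECT-EIGHT).

THEOREM (`isNondegenerate_of_isPrimitive_of_mod_two_pow`).  If `p mod 2^{a+2} = 2^{a+1} + 1`, i.e. `v₂(p − 1) = a + 1`,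
then EVERY PRIMITIVE CM type of `K` is NONDEGENERATE (rank `2^{a+1}p + 1`); hence every SIMPLE abelian variety (dimension
`2^{a+1}p`) with complex multiplication by `K` satisfies the HODGE CONJECTURE together with ALL ITS POWERS
(`hodgeConjectureFor_pow_of_isSimple_of_mod_two_pow`).  In words: **for every odd prime `p`, the metacyclic group
`C_p ⋊ C_{2^{v₂(p−1)+1}}` is GOOD.**  The conditional form (`isNondegenerate_of_isPrimitive_cyclicSemidirect`, hypothesis
`hN`: no primitive `2^{a+1}`-th root of unity is a quotient of norms `z ρ(z)`) holds for every `a`; `hN` is the local norm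
obstruction at `p`, available exactly when `2^{a+2} ∤ p^f − 1` — the seat census confirms the boundary (`C₃ ⋊ C₈`, `C₇ ⋊ C₈`,
`C₁₁ ⋊ C₈` BAD; `C₅ ⋊ C₈`, `C₁₃ ⋊ C₈`, `C₃ ⋊ C₁₆`, `C₅ ⋊ C₁₆`, `C₃ ⋊ C₃₂` GOOD).

* §1 `map_complexConj_eq`, `finrank_eq`.
* §2 `isNondegenerate_of_isPrimitive_cyclicSemidirect` (conditional on `hN`).
* §3 **`isNondegenerate_of_isPrimitive_of_mod_two_pow`**, `cmTypeRank_eq_of_isPrimitive_of_mod_two_pow`,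
  **`hodgeConjectureFor_pow_of_isSimple_of_mod_two_pow`**, `hodgeConjectureFor_of_isSimple_of_mod_two_pow`,
  `hodgeClassSpan_pow_eq_divisorClassesSpan_of_isSimple_of_mod_two_pow`, `dim_eq_of_cyclicSemidirect`.
* §4 instances: `C₄₁ ⋊ C₁₆` (`a = 2`, order `656`), `C₁₇ ⋊ C₃₂` (`a = 3`, order `544`), `C₅ ⋊ C₈` again (`a = 1`).

## References

* [Kubota1965] T. Kubota, Trans. AMS 118 (1965), §2, §4 Lemma 2.
* [Dodson1984] B. Dodson, *The structure of Galois groups of CM-fields*, Trans. AMS 283 (1984), §3.1, §5.3.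
* [Shimura1998] G. Shimura, *Abelian Varieties with Complex Multiplication and Modular Functions*, §8.2 Prop. 26.
* [Gordon1999HodgeAVSurvey] B. B. Gordon, *A survey of the Hodge conjecture for abelian varieties*, Thm. 6.4, §9.4.
* [FeinGordonSmith1971] B. Fein, B. Gordon, J. H. Smith, J. Number Theory 3 (1971), 310–315.
-/

noncomputable section

open CategoryTheory CategoryTheory.Limits NumberField
open scoped BigOperators

namespace Summit.HodgeConjecture.CorCM.GaloisCyclicSemidirectTwoPower

open Literature.NumberTheory.ComplexMultiplication
open Literature.AlgebraicGeometry.Motives (AbelianVariety CMType)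
open Literature.AlgebraicGeometry.HodgeTheory
open Literature.AlgebraicGeometry.ComplexMultiplication (IsCMTypeRealisation isSimple_iff_isPrimitive)
open Literature.AlgebraicGeometry.Pohlmann1968
open Summit.HodgeConjecture.CorCM.GaloisRank
open Summit.HodgeConjecture.CorCM.CyclotomicTwoPowerP (exists_subfield_rho)

/-! ## §1 Complex conjugation and the degree -/

section Involution

variable {p a : ℕ} [Fact p.Prime]
variable (φ : Multiplicative (ZMod (2 ^ (a + 2))) →* MulAut (Multiplicative (ZMod p)))
  (hφ : ∀ v : Multiplicative (ZMod p), φ (Multiplicative.ofAdd 1) v = v⁻¹)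
variable {K : Type} [Field K] [NumberField K] [IsCMField K]

include hφ in
/-- Complex conjugation maps to `y^{2^{a+1}} = inr 2^{a+1}` under any isomorphism `Gal(K/ℚ) ≃ C_p ⋊ C_{2^{a+2}}`.
[folklore] -/
theorem map_complexConj_eq (hp2 : p ≠ 2)
    (e : (K ≃ₐ[ℚ] K) ≃* Multiplicative (ZMod p) ⋊[φ] Multiplicative (ZMod (2 ^ (a + 2)))) :
    e ((IsCMField.complexConj K).restrictScalars ℚ) =
      SemidirectProduct.inr (Multiplicative.ofAdd ((2 ^ (a + 1) : ℕ) : ZMod (2 ^ (a + 2)))) :=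
  involution_eq φ hφ Fact.out hp2 _ (model_complexConj_mul_self e rfl) (model_complexConj_ne_one e rfl)

omit [IsCMField K] in
/-- `[K:ℚ] = 2^{a+2} p`. [folklore] -/
theorem finrank_eq [IsGalois ℚ K] (e : (K ≃ₐ[ℚ] K) ≃* Multiplicative (ZMod p) ⋊[φ] Multiplicative (ZMod (2 ^ (a + 2)))) :
    Module.finrank ℚ K = 2 ^ (a + 2) * p := by
  have hp : p.Prime := Fact.out
  haveI : NeZero p := ⟨hp.ne_zero⟩
  haveI : Fintype (Multiplicative (ZMod p) ⋊[φ] Multiplicative (ZMod (2 ^ (a + 2)))) :=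
    Fintype.ofEquiv _ SemidirectProduct.equivProd.symm
  rw [← card_model_eq_finrank e, card_eq]

end Involution

/-! ## §2 Nondegeneracy, conditional form -/

section Field

variable {p a : ℕ} [Fact p.Prime]
variable {K : Type} [Field K] [NumberField K] [IsCMField K] [IsGalois ℚ K]

/-- **THEOREM (conditional form).  `Gal(K/ℚ) ≅ C_p ⋊ C_{2^{a+2}}` (`p` odd, `φ(1)` = inversion) and no primitive
`2^{a+1}`-th root of unity is a quotient of norms `z ρ(z)` for a subfield `M ⊇ μ_{2^{a+1}p}` of `ℂ` and a ring map `ρ`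
fixing `μ_{2^{a+1}}`, inverting `μ_p`: every PRIMITIVE CM type of `K` is NONDEGENERATE.**
[cite: Kubota1965, §4 Lemma 2] [cite: Shimura1998, §8.2 Prop. 26] -/
theorem isNondegenerate_of_isPrimitive_cyclicSemidirect (hp2 : p ≠ 2)
    (φ : Multiplicative (ZMod (2 ^ (a + 2))) →* MulAut (Multiplicative (ZMod p)))
    (hφ : ∀ v : Multiplicative (ZMod p), φ (Multiplicative.ofAdd 1) v = v⁻¹)
    (M : Subfield ℂ) (ρ : M →+* ℂ) (hM : ∀ z : ℂ, z ^ (2 ^ (a + 1) * p) = 1 → z ∈ M)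
    (hρ2 : ∀ z : M, (z : ℂ) ^ 2 ^ (a + 1) = 1 → ρ z = z) (hρp : ∀ z : M, (z : ℂ) ^ p = 1 → ρ z = (z : ℂ)⁻¹)
    (hN : ∀ (z₁ z₂ : M) (ω : ℂ), ω ^ 2 ^ a = -1 → (z₁ : ℂ) * ρ z₁ = ω * ((z₂ : ℂ) * ρ z₂) →
      (z₁ : ℂ) = 0 ∧ (z₂ : ℂ) = 0)
    (e : (K ≃ₐ[ℚ] K) ≃* Multiplicative (ZMod p) ⋊[φ] Multiplicative (ZMod (2 ^ (a + 2)))) {Φ : CMType K}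
    (φ₀ : K →+* ℂ) (hprim : IsPrimitive (ℂ ≃+* ℂ) Φ.1 φ₀) : IsNondegenerate Φ := by
  classical
  have hp : p.Prime := Fact.out
  haveI : NeZero p := ⟨hp.ne_zero⟩
  haveI : Fintype (Multiplicative (ZMod p) ⋊[φ] Multiplicative (ZMod (2 ^ (a + 2)))) :=
    Fintype.ofEquiv _ SemidirectProduct.equivProd.symm
  have hc := map_complexConj_eq φ hφ hp2 e
  set S : Finset (Multiplicative (ZMod p) ⋊[φ] Multiplicative (ZMod (2 ^ (a + 2)))) :=
    Finset.univ.filter fun y => embOf φ₀ (e.symm y) ∈ Φ.1 with hS_def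
  have hS : ∀ y, y ∈ S ↔ embOf φ₀ (e.symm y) ∈ Φ.1 := fun y => by
    simp only [hS_def, Finset.mem_filter, Finset.mem_univ, true_and]
  have hScm := model_mul_mem_iff e hc Φ φ₀ S hS
  have hv1 : (SemidirectProduct.inl (Multiplicative.ofAdd (((2 ^ (a + 1) : ℕ) : ZMod p))) :
      Multiplicative (ZMod p) ⋊[φ] Multiplicative (ZMod (2 ^ (a + 2)))) ≠ 1 := by
    intro h
    rw [← map_one (SemidirectProduct.inl : Multiplicative (ZMod p) →* _), SemidirectProduct.inl_inj] at h
    have h4 : (((2 ^ (a + 1) : ℕ) : ZMod p)) = 0 := by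
      have := congrArg Multiplicative.toAdd h
      simpa using this
    rw [ZMod.natCast_eq_zero_iff] at h4
    exact hp2 ((Nat.prime_dvd_prime_iff_eq hp Nat.prime_two).1 (hp.dvd_of_dvd_pow h4))
  have hstab : ¬ ∀ w : Multiplicative (ZMod p) ⋊[φ] Multiplicative (ZMod (2 ^ (a + 2))),
      w ∈ S ↔ SemidirectProduct.inl (Multiplicative.ofAdd (((2 ^ (a + 1) : ℕ) : ZMod p))) * w ∈ S :=
    fun h => not_isPrimitive_of_leftStabiliser e Φ φ₀ S hS hv1 h hprim
  exact (isNondegenerate_iff_forall_annihilator e hc Φ φ₀ S hS).2 fun b hb hann =>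
    eq_zero_of_annihilated_cyclicSemidirect hp2 φ hφ M ρ hM hρ2 hρp hN S hScm hstab b hb hann

end Field

/-! ## §3 Nondegeneracy and the Hodge conjecture for `v₂(p − 1) = a + 1` — unconditionally -/

section Unconditional

variable {p a : ℕ} [Fact p.Prime]
variable {K : Type} [Field K] [NumberField K] [IsCMField K] [IsGalois ℚ K]
variable {Φ : CMType K} {A : AbelianVariety ℂ} {ι : 𝓞 K →+* End A}
  {θ : K →+* Module.End ℂ (complexBetti A.X 1)}

omit [Fact p.Prime] in
/-- `p mod 2^{a+2} = 2^{a+1} + 1` forces `p ≠ 2`. [folklore] -/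
theorem ne_two_of_mod_two_pow (hpa : p % 2 ^ (a + 2) = 2 ^ (a + 1) + 1) : p ≠ 2 := by
  obtain ⟨t, ht⟩ := CyclotomicTwoPowerP.exists_eq_two_pow_mul hpa
  rintro rfl
  have h2 : 2 ≤ 2 ^ (a + 1) := by
    have : 2 ^ 1 ≤ 2 ^ (a + 1) := Nat.pow_le_pow_right (by norm_num) (by omega)
    simpa using this
  nlinarith

/-- **THEOREM.  `Gal(K/ℚ) ≅ C_p ⋊ C_{2^{a+2}}` (`φ(1)` = inversion) with `p mod 2^{a+2} = 2^{a+1} + 1`: every PRIMITIVE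
CM type of `K` is NONDEGENERATE** — unconditionally. [cite: Kubota1965, §4 Lemma 2] [cite: Shimura1998, §8.2 Prop. 26]
[cite: FeinGordonSmith1971, pp. 310–315] -/
theorem isNondegenerate_of_isPrimitive_of_mod_two_pow (hpa : p % 2 ^ (a + 2) = 2 ^ (a + 1) + 1)
    (φ : Multiplicative (ZMod (2 ^ (a + 2))) →* MulAut (Multiplicative (ZMod p)))
    (hφ : ∀ v : Multiplicative (ZMod p), φ (Multiplicative.ofAdd 1) v = v⁻¹)
    (e : (K ≃ₐ[ℚ] K) ≃* Multiplicative (ZMod p) ⋊[φ] Multiplicative (ZMod (2 ^ (a + 2)))) {Φ : CMType K}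
    (φ₀ : K →+* ℂ) (hprim : IsPrimitive (ℂ ≃+* ℂ) Φ.1 φ₀) : IsNondegenerate Φ := by
  obtain ⟨M, ρ, hM, hρ2, hρp, hN⟩ := exists_subfield_rho (a := a) (Fact.out : p.Prime) hpa
  exact isNondegenerate_of_isPrimitive_cyclicSemidirect (ne_two_of_mod_two_pow hpa) φ hφ M ρ hM hρ2 hρp hN e φ₀ hprim

/-- The rank: `cmTypeRank Φ = 2^{a+1} p + 1`. [cite: Kubota1965, §2 (p. 115)] -/
theorem cmTypeRank_eq_of_isPrimitive_of_mod_two_pow (hpa : p % 2 ^ (a + 2) = 2 ^ (a + 1) + 1)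
    (φ : Multiplicative (ZMod (2 ^ (a + 2))) →* MulAut (Multiplicative (ZMod p)))
    (hφ : ∀ v : Multiplicative (ZMod p), φ (Multiplicative.ofAdd 1) v = v⁻¹)
    (e : (K ≃ₐ[ℚ] K) ≃* Multiplicative (ZMod p) ⋊[φ] Multiplicative (ZMod (2 ^ (a + 2)))) {Φ : CMType K}
    (φ₀ : K →+* ℂ) (hprim : IsPrimitive (ℂ ≃+* ℂ) Φ.1 φ₀) : cmTypeRank Φ = 2 ^ (a + 1) * p + 1 := by
  have h := isNondegenerate_of_isPrimitive_of_mod_two_pow hpa φ hφ e φ₀ hprim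
  rw [isNondegenerate_iff, finrank_eq φ e] at h
  rw [h, pow_succ 2 (a + 1)]
  have : 0 < 2 ^ (a + 1) * p := by have := (Fact.out : p.Prime).pos; positivity
  rw [show 2 ^ (a + 1) * 2 * p = 2 ^ (a + 1) * p * 2 by ring]
  omega

/-- **THE HODGE CONJECTURE FOR EVERY POWER OF EVERY SIMPLE ABELIAN VARIETY WITH COMPLEX MULTIPLICATION BY A GALOIS CM
FIELD WITH GROUP `C_p ⋊ C_{2^{a+2}}`, `v₂(p − 1) = a + 1`** (dimension `2^{a+1} p`) — unconditionally; for every odd prime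
`p` exactly one `a` qualifies. [cite: Gordon1999HodgeAVSurvey, Thm. 6.4] [cite: Shimura1998, §8.2 Prop. 26] -/
theorem hodgeConjectureFor_pow_of_isSimple_of_mod_two_pow (hpa : p % 2 ^ (a + 2) = 2 ^ (a + 1) + 1)
    (φ : Multiplicative (ZMod (2 ^ (a + 2))) →* MulAut (Multiplicative (ZMod p)))
    (hφ : ∀ v : Multiplicative (ZMod p), φ (Multiplicative.ofAdd 1) v = v⁻¹)
    (e : (K ≃ₐ[ℚ] K) ≃* Multiplicative (ZMod p) ⋊[φ] Multiplicative (ZMod (2 ^ (a + 2))))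
    (hA : IsCMTypeRealisation Φ A ι θ) (hs : A.IsSimple) (N : ℕ) :
    HodgeConjectureFor (⨁ fun _ : Fin N => A).dim (⨁ fun _ : Fin N => A).X := by
  obtain ⟨φ₀⟩ := (inferInstance : Nonempty (K →+* ℂ))
  exact (isNondegenerate_of_isPrimitive_of_mod_two_pow hpa φ hφ e φ₀
    ((isSimple_iff_isPrimitive hA φ₀).1 hs)).hodgeConjectureFor_pow hA N

/-- The Hodge conjecture for the simple abelian variety itself. [cite: Gordon1999HodgeAVSurvey, Thm. 6.4] -/
theorem hodgeConjectureFor_of_isSimple_of_mod_two_pow (hpa : p % 2 ^ (a + 2) = 2 ^ (a + 1) + 1)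
    (φ : Multiplicative (ZMod (2 ^ (a + 2))) →* MulAut (Multiplicative (ZMod p)))
    (hφ : ∀ v : Multiplicative (ZMod p), φ (Multiplicative.ofAdd 1) v = v⁻¹)
    (e : (K ≃ₐ[ℚ] K) ≃* Multiplicative (ZMod p) ⋊[φ] Multiplicative (ZMod (2 ^ (a + 2))))
    (hA : IsCMTypeRealisation Φ A ι θ) (hs : A.IsSimple) : HodgeConjectureFor A.dim A.X := by
  obtain ⟨φ₀⟩ := (inferInstance : Nonempty (K →+* ℂ))
  exact (isNondegenerate_of_isPrimitive_of_mod_two_pow hpa φ hφ e φ₀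
    ((isSimple_iff_isPrimitive hA φ₀).1 hs)).hodgeConjectureFor hA

/-- `Bᵐ(Aⁿ) ⊗ ℂ = Dᵐ(Aⁿ) ⊗ ℂ` on every power (White–Hazama). [cite: Gordon1999HodgeAVSurvey, §9.3] -/
theorem hodgeClassSpan_pow_eq_divisorClassesSpan_of_isSimple_of_mod_two_pow
    (hpa : p % 2 ^ (a + 2) = 2 ^ (a + 1) + 1)
    (φ : Multiplicative (ZMod (2 ^ (a + 2))) →* MulAut (Multiplicative (ZMod p)))
    (hφ : ∀ v : Multiplicative (ZMod p), φ (Multiplicative.ofAdd 1) v = v⁻¹)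
    (e : (K ≃ₐ[ℚ] K) ≃* Multiplicative (ZMod p) ⋊[φ] Multiplicative (ZMod (2 ^ (a + 2))))
    (hA : IsCMTypeRealisation Φ A ι θ) (hs : A.IsSimple) (N m : ℕ) :
    Literature.AlgebraicGeometry.VanGeemen1994.hodgeClassSpan (⨁ fun _ : Fin N => A).dim (⨁ fun _ : Fin N => A).X m =
      Literature.Barriers.HodgeConjecture.divisorClassesSpan (⨁ fun _ : Fin N => A).X
        (⨁ fun _ : Fin N => A).dim m := by
  obtain ⟨φ₀⟩ := (inferInstance : Nonempty (K →+* ℂ))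
  exact (isNondegenerate_of_isPrimitive_of_mod_two_pow hpa φ hφ e φ₀
    ((isSimple_iff_isPrimitive hA φ₀).1 hs)).hodgeClassSpan_pow_eq_divisorClassesSpan hA N m

omit [IsCMField K] in
/-- … and such a simple abelian variety has dimension `2^{a+1} p`. [cite: Shimura1998, §8.2 Prop. 26] -/
theorem dim_eq_of_cyclicSemidirect (φ : Multiplicative (ZMod (2 ^ (a + 2))) →* MulAut (Multiplicative (ZMod p)))
    (e : (K ≃ₐ[ℚ] K) ≃* Multiplicative (ZMod p) ⋊[φ] Multiplicative (ZMod (2 ^ (a + 2))))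
    (hA : IsCMTypeRealisation Φ A ι θ) : A.dim = 2 ^ (a + 1) * p := by
  have h : A.dim = Module.finrank ℚ K / 2 := Literature.AlgebraicGeometry.Motives.schemeDim_eq_holds hA.1
  rw [finrank_eq φ e, pow_succ 2 (a + 1)] at h
  rw [h, show 2 ^ (a + 1) * 2 * p = 2 ^ (a + 1) * p * 2 by ring, Nat.mul_div_cancel _ (by norm_num)]

end Unconditional

/-! ## §4 Instances: `C₄₁ ⋊ C₁₆`, `C₁₇ ⋊ C₃₂`, `C₅ ⋊ C₈` -/

section Instances

variable {K : Type} [Field K] [NumberField K] [IsCMField K] [IsGalois ℚ K]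
variable {Φ : CMType K} {A : AbelianVariety ℂ} {ι : 𝓞 K →+* End A}
  {θ : K →+* Module.End ℂ (complexBetti A.X 1)}

/-- **`C₄₁ ⋊ C₁₆` (order `656`, `a = 2`, `41 ≡ 9 (mod 16)`) is GOOD**: the Hodge conjecture for every power of every simple
CM abelian `328`-fold with complex multiplication by a Galois CM field with this group. [cite: Gordon1999HodgeAVSurvey, Thm. 6.4] -/
theorem hodgeConjectureFor_pow_of_isSimple_cyclic41_semidirect_16
    (φ : Multiplicative (ZMod (2 ^ (2 + 2))) →* MulAut (Multiplicative (ZMod 41)))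
    (hφ : ∀ v : Multiplicative (ZMod 41), φ (Multiplicative.ofAdd 1) v = v⁻¹)
    (e : (K ≃ₐ[ℚ] K) ≃* Multiplicative (ZMod 41) ⋊[φ] Multiplicative (ZMod (2 ^ (2 + 2))))
    (hA : IsCMTypeRealisation Φ A ι θ) (hs : A.IsSimple) (N : ℕ) :
    HodgeConjectureFor (⨁ fun _ : Fin N => A).dim (⨁ fun _ : Fin N => A).X :=
  haveI : Fact (Nat.Prime 41) := ⟨by norm_num⟩
  hodgeConjectureFor_pow_of_isSimple_of_mod_two_pow (a := 2) (by norm_num) φ hφ e hA hs N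

/-- **`C₁₇ ⋊ C₃₂` (order `544`, `a = 3`, `17 ≡ 17 (mod 32)`) is GOOD**: the Hodge conjecture for every power of every simple
CM abelian `272`-fold with complex multiplication by a Galois CM field with this group. [cite: Gordon1999HodgeAVSurvey, Thm. 6.4] -/
theorem hodgeConjectureFor_pow_of_isSimple_cyclic17_semidirect_32
    (φ : Multiplicative (ZMod (2 ^ (3 + 2))) →* MulAut (Multiplicative (ZMod 17)))
    (hφ : ∀ v : Multiplicative (ZMod 17), φ (Multiplicative.ofAdd 1) v = v⁻¹)
    (e : (K ≃ₐ[ℚ] K) ≃* Multiplicative (ZMod 17) ⋊[φ] Multiplicative (ZMod (2 ^ (3 + 2))))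
    (hA : IsCMTypeRealisation Φ A ι θ) (hs : A.IsSimple) (N : ℕ) :
    HodgeConjectureFor (⨁ fun _ : Fin N => A).dim (⨁ fun _ : Fin N => A).X :=
  haveI : Fact (Nat.Prime 17) := ⟨by norm_num⟩
  hodgeConjectureFor_pow_of_isSimple_of_mod_two_pow (a := 3) (by norm_num) φ hφ e hA hs N

/-- `C₅ ⋊ C₈` once more, as the case `a = 1` (cf. `CorCM/GaloisCyclicSemidirectEightFiveModEight`): every primitive CM type
is nondegenerate of rank `21`. [cite: Kubota1965, §4 Lemma 2] -/
theorem isNondegenerate_of_isPrimitive_cyclic5_semidirect_8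
    (φ : Multiplicative (ZMod (2 ^ (1 + 2))) →* MulAut (Multiplicative (ZMod 5)))
    (hφ : ∀ v : Multiplicative (ZMod 5), φ (Multiplicative.ofAdd 1) v = v⁻¹)
    (e : (K ≃ₐ[ℚ] K) ≃* Multiplicative (ZMod 5) ⋊[φ] Multiplicative (ZMod (2 ^ (1 + 2)))) (Φ : CMType K)
    (φ₀ : K →+* ℂ) (hprim : IsPrimitive (ℂ ≃+* ℂ) Φ.1 φ₀) : IsNondegenerate Φ ∧ cmTypeRank Φ = 21 :=
  haveI : Fact (Nat.Prime 5) := ⟨Nat.prime_five⟩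
  ⟨isNondegenerate_of_isPrimitive_of_mod_two_pow (a := 1) (by norm_num) φ hφ e φ₀ hprim, by
    have h := cmTypeRank_eq_of_isPrimitive_of_mod_two_pow (a := 1) (by norm_num) φ hφ e φ₀ hprim
    rw [h]; norm_num⟩

end Instances

end Summit.HodgeConjecture.CorCM.GaloisCyclicSemidirectTwoPower

end
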